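import Mathlib

/-!
# `Balaban1983to89.B3Sect3Statements` — T. Bałaban, *(Higgs)₂,₃ quantum fields in a finite volume. III. Renormalization*,
Commun. Math. Phys. **88** (1983) 411–445 [Balaban1983Higgs3]: Sect. 3 "A Proof of Proposition 1" — the reductions (3.1),
(3.2), (3.3), the decomposition statement (3.5), the lattice Taylor formula (3.10), and the parity mechanism of (3.37)–(3.38)

statement-level skeleton of published theorems with citation tags; proofs where landed; nothing here is a claim about the Yang–Mills mass gap

PDF held: `paper:balaban1983-higgs-2-3-quantum-fields-finite-volume` (journal page = PDF page + 410).  Renders read as images: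
`run/shared/lean/pub/pub-balaban/b2b-balaban-ref1/pages/1983-cmp88-higgs23-III/1983-cmp88-higgs23-III-p022, p023, p024, p025,
p031, p034, p035-x4.png` (journal pp. 432, 433, 434, 435, 441, 444, 445).

CITATION HEADER (lean-in-tree rule).  Part of the lit-balaban TYPED SKELETON (HOME `run/shared/lean/pub/lit-balaban/`; rows B3-27 …
B3-32, B3-36 … B3-40 of `HOME/lit-balaban-r15/SKELETON-r15.md`).  WHAT IS REPRODUCED, and how.  (a) As `def … : Prop` over an
abstract carrier `Sect3Data` (fields NAME the printed quantities; carrier clauses listed at the structure): the localisation bound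
**(3.1)** p. 432, the reduced estimates **(3.2)** p. 432 and **(3.3)** p. 433, and the decomposition statement **(3.5)** p. 434
("To each class G_ren there corresponds some family G′_ren of generalized graphs such that …").  (b) PROVED: the lattice Taylor
formula **(3.10)** p. 435 as the telescoping identity it is, for a function on an additive group of lattice points with values in
an additive commutative group, along an arbitrary finite contour given by its steps (`taylor310`; the printed form groups the
second sum by coordinate directions for a shortest contour — see the docstring); and the parity mechanism of **(3.38)** p. 444
("= 0, because the functions which we are summing are odd"): on a finite additive group (the torus T_ξ) the sum of an odd function
vanishes (`sum_eq_zero_of_odd`) and, for even C, C̃, the summand y ↦ C̃(y)(C(y + a) − C(y − a)) of (3.38) is odd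
(`odd_even_mul_centralDiff`, `sum_even_mul_centralDiff_eq_zero`).  Cited for METHOD by [Balaban1987RG1] p. 288 ("(3.10) [7]") and
p. 285 ("(3.25)–(3.32) [7]").  NOT typed here (rows only): the displays (3.4), (3.6)–(3.9), (3.11)–(3.36) (the case-by-case
renormalization of the primitively divergent graphs, graphical) and the momentum-space evaluations (3.28), (3.37) — Phase 2.
NOTHING of the paper is asserted beyond the kernel-checked lemmas: `Ineq31`, `Ineq32`, `Ineq33`, `Claim35` are hypotheses for
consumers.  Unit `lit-balaban-r15` (reader/typer r15).
-/

namespace Literature.MathematicalPhysics.QuantumFieldTheory.Balaban1983to89.B3Sect3Statements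

open Finset

/-! ## (3.1)–(3.3) and the decomposition statement (3.5) -/

/-- Abstract carrier for Sect. 3: renormalized classes G_ren with localizations and external fields (as in Sect. 1), the
localizing functions h, h′ of two vertices with the distance dist(□(v), □(v′)) of their cubes, the Hölder norm
‖hG_k(Ω,B̃)h′‖_{1,α} of the propagator between them, the expression E(G′_ren, {□(v)}, Φ′_ext, A′_ext) of the classes G′_ren obtained
on p. 432 by replacing long lines by pairs of external legs, its orders d_v, d_s, the running couplings, the norms ‖Φ′_ext‖_{1,α},
‖A′_ext‖_{1,α} WITHOUT localizing functions (3.2), and — for (3.5) — the triple sum Σ_{G∈G_ren}Σ_{orderings l̃}Σ_{j∈J(l̃)}E(G(j),…)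
of (3.4), the families of generalized graphs with their characteristic functions γ(G′, l̃′) of sets of orderings, the corresponding
sum of generalized expressions, and the predicate "every ordering in the set defines a sequence of subgraphs G′₁, …, G′_m with
positive degrees".  Carrier clauses (F6): all of these are data of the instance; p. 433's gauge transformation removing B₀ and the
replacement G_k(□,0) = G_k(0) + δG_k are inside `E3`. [cite: Balaban1983Higgs3, (3.1)–(3.5) pp.432–434] -/
structure Sect3Data where
  /-- e(L^kε) -/
  eRun : ℝ
  /-- λ(L^kε) -/
  lamRun : ℝ
  /-- localizing functions h of vertices -/
  LocFn : Type
  /-- dist(□(v), □(v′)) for the cubes on which h, h′ localize -/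
  distCubes : LocFn → LocFn → ℝ
  /-- α ↦ ‖h G_k(Ω, B̃) h′‖_{1,α} -/
  normHGH : ℝ → LocFn → LocFn → ℝ
  /-- the classes G′_ren of p. 432 (lines between distant cubes replaced by external legs) -/
  RenClass' : Type
  /-- localizations of a class -/
  Loc : RenClass' → Type
  /-- external scalar fields Φ′_ext -/
  ExtS : Type
  /-- external vector fields A′_ext -/
  ExtV : Type
  /-- E(G′_ren, {□(v)}, Φ′_ext, A′_ext) -/
  E' : (G : RenClass') → Loc G → ExtS → ExtV → ℝ
  /-- the expression of (3.3): couplings extracted, B₀ gauged away, propagator G_k(0) (p. 433) -/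
  E3 : (G : RenClass') → Loc G → ExtS → ExtV → ℝ
  /-- d_v(G′_ren) -/
  dv : RenClass' → ℕ
  /-- d_s(G′_ren) -/
  ds : RenClass' → ℕ
  /-- α ↦ ‖Φ′_ext‖_{1,α} -/
  normS : ℝ → ExtS → ℝ
  /-- α ↦ ‖A′_ext‖_{1,α} -/
  normV : ℝ → ExtV → ℝ
  /-- the left side of (3.5): Σ_{G∈G_ren} Σ_{orderings l̃} Σ_{j∈J(l̃)} E(G(j), {□(v)}, Φ_ext, A_ext), per class (cf. (2.7)) -/
  lhs35 : (G : RenClass') → Loc G → ExtS → ExtV → ℝ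
  /-- families G′_ren of generalized graphs attached to a class, with their γ(G′, l̃′) -/
  GenFamily : RenClass' → Type
  /-- the right side of (3.5) for a family: Σ_{G′∈G′_ren} Σ_{l̃′} Σ_{j∈J(l̃′)} γ(G′,l̃′)E′(G′(j), {□(v)}, Φ_ext, A_ext) -/
  rhs35 : (G : RenClass') → GenFamily G → Loc G → ExtS → ExtV → ℝ
  /-- "This set [of orderings] has the property that a sequence of subgraphs G′₁, G′₂, …, G′_m = G defined by an ordering l̃′
  from the set consists of subgraphs with positive degrees D(G′_i) > 0." -/
  PosAlongOrderings : (G : RenClass') → GenFamily G → Prop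

namespace Sect3Data

variable (S : Sect3Data)

/-- **(3.1)** p. 432 [PDF 22], verbatim: *"Now if two vertices, v, v′ have localizations satisfying dist(□(v), □(v′)) ≥ 1, then we
consider every propagator corresponding to a line connecting these vertices as an external field also. Such a possibility is
assured by the following estimates ‖hG_k(Ω,B̃)h′‖_{1,α} ≤ O(1)e^{−δ₀dist(□(v),□(v′))}, (3.1) and similarly for the vector field
propagator, h, h′ are localization functions."* — at constants (α, δ₀, O(1) = C). [cite: Balaban1983Higgs3, (3.1) p.432] -/
def Ineq31 (α δ₀ C : ℝ) : Prop :=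
  ∀ h h' : S.LocFn, 1 ≤ S.distCubes h h' → S.normHGH α h h' ≤ C * Real.exp (-(δ₀ * S.distCubes h h'))

/-- **(3.2)** p. 432 [PDF 22], verbatim: *"To prove (1.33) it is sufficient to prove the estimates
|E(G′_ren, {□(v)}_{v∈G′_ren}, Φ′_ext, A′_ext)| ≤ O(1)(e(L^kε))^{d_v(G′_ren)}(λ(L^kε))^{d_s(G′_ren)}‖Φ′_ext‖_{1,α₀}‖A′_ext‖_{1,α₀}, (3.2)
because these estimates and (2.5), (3.1) imply (1.33), and the exponential factor in (1.33) is obtained from the estimates of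
external fields in (3.2)."* [cite: Balaban1983Higgs3, (3.2) p.432] -/
def Ineq32 (α₀ C : ℝ) : Prop :=
  ∀ (G : S.RenClass') (loc : S.Loc G) (Φ : S.ExtS) (A : S.ExtV),
    |S.E' G loc Φ A| ≤ C * S.eRun ^ S.dv G * S.lamRun ^ S.ds G * S.normS α₀ Φ * S.normV α₀ A

/-- **(3.3)** p. 433 [PDF 23], verbatim: *"We have to prove the inequality (3.2) for these expressions. Considering each connected
component of G_ren separately we can assume additionally that G_ren is connected. We can extract also all coupling constants, so
finally we have to prove the estimate |E(G_ren, {□(v)}_{v∈G_ren}, Φ_ext, A_ext)| ≤ O(1)‖Φ_ext‖_{1,α₀}‖A_ext‖_{1,α₀}. (3.3)"*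
[cite: Balaban1983Higgs3, (3.3) p.433] -/
def Ineq33 (α₀ C : ℝ) : Prop :=
  ∀ (G : S.RenClass') (loc : S.Loc G) (Φ : S.ExtS) (A : S.ExtV), |S.E3 G loc Φ A| ≤ C * S.normS α₀ Φ * S.normV α₀ A

/-- **(3.5)** p. 434 [PDF 24], verbatim: *"More exactly we will prove the following statement: To each class G_ren there corresponds
some family G′_ren of generalized graphs such that Σ_{G∈G_ren}Σ_{l̃}Σ_{j∈J(l̃)} E(G(j), {□(v)}_{v∈G}, Φ_ext, A_ext) =
Σ_{G′∈G′_ren}Σ_{l̃′}Σ_{j∈J(l̃′)} γ(G′,l̃′)E′(G′(j), {□(v)}_{v∈G′}, Φ_ext, A_ext), (3.5) where E′(G′, …) is a generalized expression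
corresponding to the graph G′ and γ(G′, l̃′) is a characteristic function of some set of orderings l̃′. This set has the property
that a sequence of subgraphs G′₁, G′₂, …, G′_m = G defined by an ordering l̃′ from the set consists of subgraphs with positive degrees
D(G′_i) > 0."*  p. 434: *"Of course this statement and Proposition 2.2 imply the inequality (3.3)."*  Printed proof: pp. 434–445.
[cite: Balaban1983Higgs3, (3.5) p.434] -/
def Claim35 (S₀ : Sect3Data) : Prop :=
  ∀ G : S₀.RenClass', ∃ F : S₀.GenFamily G,
    S₀.PosAlongOrderings G F ∧ ∀ (loc : S₀.Loc G) (Φ : S₀.ExtS) (A : S₀.ExtV), S₀.lhs35 G loc Φ A = S₀.rhs35 G F loc Φ A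

end Sect3Data

/-! ## (3.10): the lattice Taylor formula, proved -/

/-- **(3.10)** p. 435 [PDF 25], verbatim: *"To this expression we apply Taylor's formula in the form
f(y) = f(x) + Σ_{μ=1}^d (y_μ − x_μ)(∂^η_μ f)(x) + Σ_{b⊂Γ_{x,y}} η|b₋ − x|^α ((∂^ηf)(b) − (∂^ηf)((b)_x))/|b₋ − x|^α, (3.10) where (b)_x
denotes a bond b parallel-transported to the point x."*  PROVED as the identity it is, for `f` on an additive group of lattice
points `X` with values in an additive commutative group `M`, along a contour from `x` given by its steps `v 0, …, v (m−1)` (the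
i-th bond b_i goes from p_i = x + Σ_{j<i} v_j to p_{i+1}; its transport to x is the bond from x to x + v_i): with
η(∂^ηf)(b) = f(b₊) − f(b₋) (the series' bond-difference convention, [Balaban1984PropagatorsI] (1.4)),
f(p_m) = f(x) + Σ_i [f(x + v_i) − f(x)] + Σ_i ([f(p_{i+1}) − f(p_i)] − [f(x + v_i) − f(x)]).  The printed middle term
Σ_μ (y_μ − x_μ)(∂^η_μ f)(x) is the grouping of Σ_i [f(x + v_i) − f(x)] by directions for a shortest contour Γ_{x,y} (n_μ steps
±ηe_μ in direction μ, the derivative at x taken along the contour's orientation), and the factors |b₋ − x|^α/|b₋ − x|^α = 1 only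
exhibit the Hölder quotient (the term with b₋ = x vanishes since then (b)_x = b). [cite: Balaban1983Higgs3, (3.10) p.435] -/
theorem taylor310 {X M : Type*} [AddCommMonoid X] [AddCommGroup M] (f : X → M) (x : X) (v : ℕ → X) (m : ℕ) :
    f (x + ∑ j ∈ range m, v j) =
      f x + ∑ i ∈ range m, (f (x + v i) - f x)
        + ∑ i ∈ range m, ((f (x + ∑ j ∈ range (i + 1), v j) - f (x + ∑ j ∈ range i, v j)) - (f (x + v i) - f x)) := by
  have htel := Finset.sum_range_sub (fun i => f (x + ∑ j ∈ range i, v j)) m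
  simp only [Finset.sum_range_zero, add_zero] at htel
  have hsplit : ∑ i ∈ range m, ((f (x + ∑ j ∈ range (i + 1), v j) - f (x + ∑ j ∈ range i, v j)) - (f (x + v i) - f x))
      = (∑ i ∈ range m, (f (x + ∑ j ∈ range (i + 1), v j) - f (x + ∑ j ∈ range i, v j)))
          - ∑ i ∈ range m, (f (x + v i) - f x) :=
    Finset.sum_sub_distrib _ _
  rw [hsplit, htel]
  abel

/-- The telescoping core of (3.10): Σ_{b⊂Γ_{x,y}} η(∂^ηf)(b) = f(y) − f(x) along any contour (same conventions as `taylor310`).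
[cite: Balaban1983Higgs3, (3.10) p.435] -/
theorem sum_bondDiff_eq {X M : Type*} [AddCommMonoid X] [AddCommGroup M] (f : X → M) (x : X) (v : ℕ → X) (m : ℕ) :
    ∑ i ∈ range m, (f (x + ∑ j ∈ range (i + 1), v j) - f (x + ∑ j ∈ range i, v j)) = f (x + ∑ j ∈ range m, v j) - f x := by
  rw [Finset.sum_range_sub (fun i => f (x + ∑ j ∈ range i, v j)) m]
  simp

/-! ## The parity mechanism of (3.37)–(3.38), proved -/

/-- On a finite additive commutative group `T` (the torus T_ξ of p. 444) the sum of an odd function vanishes — the sentence closing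
**(3.38)** p. 444 [PDF 34]: *"= 0, because the functions which we are summing are odd."* [cite: Balaban1983Higgs3, (3.38) p.444] -/
theorem sum_eq_zero_of_odd {T : Type*} [AddCommGroup T] [Fintype T] (F : T → ℝ) (hF : ∀ y, F (-y) = -F y) :
    ∑ y, F y = 0 := by
  have h : ∑ y, F y = ∑ y, F (-y) := (Equiv.sum_comp (Equiv.neg T) F).symm
  have h2 : ∑ y, F (-y) = -∑ y, F y := by
    rw [← Finset.sum_neg_distrib]
    exact Finset.sum_congr rfl fun y _ => hF y
  linarith

/-- The summands of **(3.38)** p. 444 [PDF 34] — *"−q³Σ_y ξ^d C^ξ(y)(C^ξ(y+ξe_μ) − C^ξ(y−ξe_μ))/ξ + q³Σ_y ξ^d(C^ξ∗C^ξ)(y)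
(C^ξ(y+ξe_μ) − C^ξ(y−ξe_μ))/ξ = 0"* — are odd: for EVEN functions C̃ (= C^ξ or C^ξ ∗ C^ξ, even by the symmetry
C^ξ(−y) = C^ξ(y) of p. 441) and C, the function y ↦ C̃(y)(C(y + a) − C(y − a)) is odd. [cite: Balaban1983Higgs3, (3.38) p.444] -/
theorem odd_even_mul_centralDiff {T : Type*} [AddCommGroup T] (Ct C : T → ℝ) (hCt : ∀ y, Ct (-y) = Ct y)
    (hC : ∀ y, C (-y) = C y) (a : T) (y : T) :
    Ct (-y) * (C (-y + a) - C (-y - a)) = -(Ct y * (C (y + a) - C (y - a))) := by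
  have h1 : C (-y + a) = C (y - a) := by rw [← hC (y - a), neg_sub, sub_eq_neg_add]
  have h2 : C (-y - a) = C (y + a) := by rw [← hC (y + a), neg_add, sub_eq_add_neg]
  rw [hCt, h1, h2]
  ring

/-- **(3.38)** p. 444 [PDF 34], the vanishing: for even C̃, C on a finite torus and any coefficient c (= ∓q³ξ^{d−1}),
Σ_y c·C̃(y)(C(y + a) − C(y − a)) = 0.  (The same parity argument is invoked for (3.37): "For the graph (2.21c) it equals 0 also
because by translation invariance it can be written as a derivative of a constant.") [cite: Balaban1983Higgs3, (3.38) p.444] -/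
theorem sum_even_mul_centralDiff_eq_zero {T : Type*} [AddCommGroup T] [Fintype T] (Ct C : T → ℝ)
    (hCt : ∀ y, Ct (-y) = Ct y) (hC : ∀ y, C (-y) = C y) (a : T) (c : ℝ) :
    ∑ y, c * (Ct y * (C (y + a) - C (y - a))) = 0 := by
  rw [← Finset.mul_sum, sum_eq_zero_of_odd _ (odd_even_mul_centralDiff Ct C hCt hC a), mul_zero]

end Literature.MathematicalPhysics.QuantumFieldTheory.Balaban1983to89.B3Sect3Statements
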